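import Summits.CriticalPhenomena.PercolationContinuityZ3.Theorems.Transplant.SkelFrmBParamsFaceCountsShiftA
import Summits.CriticalPhenomena.PercolationContinuityZ3.Theorems.Transplant.SkelFrmBParamsBridgeF
import Summits.CriticalPhenomena.PercolationContinuityZ3.Theorems.Transplant.SkelFrmBParamsBridgeFrameF
import Summits.CriticalPhenomena.PercolationContinuityZ3.Theorems.Transplant.SkelFrmBParamsSlotsF
import Summits.CriticalPhenomena.PercolationContinuityZ3.Theorems.Transplant.SkelFrmBParamsFramesF
import Summits.CriticalPhenomena.PercolationContinuityZ3.Theorems.Transplant.SkelFrmBParamsFaceFloorsTXA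
import Summits.CriticalPhenomena.PercolationContinuityZ3.Theorems.Transplant.PlanarSkeletonFrmDefs
import Summits.CriticalPhenomena.PercolationContinuityZ3.Theorems.Transplant.SkelPhiStepIDataNS
import HarnessLib
/-!
(F) VALUE LAYER, N2 twin (hp-8 g42, 2026-08-23; F-DISCHARGE-MAP-N2 G18 x-face LANDING ORIGIN at the wide (F) bridge, case same, + the origin readings):
`port_frm.py` text of N1 `SkelNegBParamsFaceOriginsXA` (p3-g12) with §0 = the N2 twins of N1 RootCases §Generic (`yLof`, `Λ₀of_yLof`, `Λ₁of_yLof`,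
`yLof_l1` — shared with the (R) column, p3-g17: import them from here); kit radius `KS0.R'0` (J19; `qBXFs := R'0`); the N1 slot-floor READS
(`ML_floorsT … .2.1`, `nL_floorsT … .2.1`) become the HYPOTHESES of record `hR0 : 22000·(R'0+2) ≤ M_L(gT mk gx)`, `hnA : 2000·Kq·(R'0+2) ≤ n_L` (device (d),
stmt-g21 (S2) discharges them on `gxQ`); over my BridgeF/BridgeFrameF/SlotsF/FramesF-N2 and p1's `Wrun_spec` (TXA, radius-free decl). Cell-free.
NON-VACUITY: hypotheses = Step I at `(gT mk gx, f)`, `16·S_F ≤ M_L`, `hR0`, `hnA`, `|d₀|,|d₁| ≤ S_F`, `0 ≤ 2mh ≤ ℓ_L + S_F`.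
builds on p205010 (kernel theorem, internal audit signed; external expert review pending); nothing here is a claim about the open node `SamePDropOfSkeletonFrm₁`.
N1 HEADER (kept for the reader):
# N1 (the `{±1}` node), M3 (the x-face linear floors at the (ζ′) tuple), group G-O part 1: **THE x-FACE LANDING ORIGIN AT THE WIDE (F) BRIDGE,
# case `o_b = o_L` (`bridgeSame` = `KS.BFs`), and the origin readings every M3 group consumes** — the RootCases twins at the F pair
# (`nBF/hBF/ℓBF c mk`, SkelNegBParamsBridgeF) asked for by hp-8 2026-08-22T06:59:17Z (2a) and the lead 06:53:24Z (G-O = p3 lineage):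
# * §1 sizes: **`abs_Λof_yLofF_le`** (`|Λ₀(yLof σ d₀ d₁ mh)| ≤ 3m`, `|Λ₁| ≤ 2m` for `|d₀|,|d₁| ≤ S_F`, `0 ≤ 2mh ≤ ℓ_L + S_F`, floor `16·S_F ≤ M_L` —
#   the F twin of `abs_Λof_yLof_le`), and the READINGS from the Λ-sizes: **`abs_FcA_le_of_Λ₀`** (`|Λ₀ y| ≤ k·m ⇒ |FcA y| ≤ k·u₀A`),
#   **`abs_F1cA_le_of_Λ₁`** (`|Λ₁ y| ≤ k·m ⇒ |F1cA y| ≤ k·u₁A`), whence the skeleton's origin premises **`he0_of_Λ₀`**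
#   (`|Λ₀ yL| ≤ 3m ⇒ |FcA (yTX0 yL σT)| ≤ 6·u₀A`, with `FcA_yTX0_sub_abs_le`) and **`he1_of_Λ₁`** (`|Λ₁ yL| ≤ 2m ⇒ |F1cA yL| ≤ 6·u₁A`);
# * §2 case same: origin **`yLXFs c mk g f σ := yLof σ nBF hBF ⌊(ℓ_L + ℓBF)/2⌋`** (centre of `KS.BFs σ`'s core `1`), half-width **`qBXFs := RA′`**,
#   `yLXFs_zero` (`σ·yLXFs₀ = n_L + nBF`), **`hxaXF_s`** (`|x₀ − σ·yL₀| ≤ qBXFs` on core `1`), **`hyL_XFs`** (p1-g14's `hclr_XA` premise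
#   `M_u < σ·yL₀ − qB − RA′ − n_L`, from `clearF`), **`four_qBXFs_le`** (G-fit's `4·qB ≤ n_L`), **`Λ_yLXFs`** (`|Λ₀| ≤ 3m ∧ |Λ₁| ≤ 2m` at the origin,
#   floor `16·S_F ≤ M_L`), **`hxbXF_s`** (core `1` inside the start window; port of `hxb_s`, floor `ℓBF + 22RA′ + 23 ≤ ℓ_L` from `16·S_F ≤ M_L`).
# Cases d/t (transposed bridge; RootCasesT twins `yLXFd/yLXFt`, `qBXFd/qBXFt`) are part 2 (p3-g13).

builds on p205010 (kernel theorem, internal audit signed; external expert review pending) — nothing in this file uses p205010; NOTHING is claimed about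
the open node `SamePDropOfSkeletonNeg₁`: pure arithmetic of the (ζ′) parameter files.
Lane `prim-bschramm`, seat `prim-bschramm-p3` (gen 12; N1 design owner, M3 integrator); helper file (`--supports stmt-CriticalPhenomena-4575 --as helper`).
[cite: KozmaNitzan2024, §4 p. 28 ((32)), Lemma 10 Step IV (pp. 17–21)] [cite: MartineauTassion2017, §3.2, §4.3]
-/

noncomputable section

open scoped Classical

namespace Summit.CriticalPhenomena.PercolationContinuityZ3.Theorems.Transplant

namespace PlanarSkeletonFrm

namespace NegB

open Literature.Probability.Percolation Literature.Probability.LatticeModels SimpleGraph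
open SkelConc (Consts)
open Skelφ (shearUnit shearUnit_pos)
open Skelφ.StepI (DataN)
open ChainPlanar (BridgePrm)
open TwoAxis.Para (modulus)
open Neg

namespace KS

/-! ## §0 The run origin `yLof` and its Λ-readings (N2 twins of N1 RootCases §Generic, p3-g12 — shared with the (R) column, p3-g17) -/

section Generic

/-- **The run origin** `yLof σ d₀ d₁ mh := (σ·(n_L + d₀), σ·(h_L + d₁) + mh)` (plain coordinates relative to the root). [this work] -/
def yLof (κ : Consts) {V : Type} [DecidableEq V] [Countable V] {G : SimpleGraph V} [G.LocallyFinite] (Φ : PlanarSkeletonFrm G) (t : V) (p : unitInterval) (D : Skelφ.StepI.DataNS V) (g : ℕ) (f : ℕ) (σ d₀ d₁ mh : ℤ) : Site 2 := Skelφ.pt (σ * ((nL κ Φ t p D g f : ℤ) + d₀)) (σ * (hL κ Φ t p D g f + d₁) + mh)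

/-- `Λ₀(yLof) = σ·m + σ·(v_β d₀ − v_L d₁) − v_L·mh`. [folklore] -/
theorem Λ₀of_yLof (κ : Consts) {V : Type} [DecidableEq V] [Countable V] {G : SimpleGraph V} [G.LocallyFinite] (Φ : PlanarSkeletonFrm G) (t : V) (p : unitInterval) (D : Skelφ.StepI.DataNS V) (g : ℕ) (f : ℕ) (σ d₀ d₁ mh : ℤ) : Λ₀of κ Φ t p D g f (yLof κ Φ t p D g f σ d₀ d₁ mh) =
    σ * modulus (nL κ Φ t p D g f) (hL κ Φ t p D g f) (vL κ Φ t p D g f) (Skelφ.NegPrm.vβOf (nL κ Φ t p D g f) (hL κ Φ t p D g f) (ℓL κ Φ t p D g f) (vL κ Φ t p D g f)) +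
      σ * (Skelφ.NegPrm.vβOf (nL κ Φ t p D g f) (hL κ Φ t p D g f) (ℓL κ Φ t p D g f) (vL κ Φ t p D g f) * d₀ - vL κ Φ t p D g f * d₁) - vL κ Φ t p D g f * mh := by
  unfold Λ₀of yLof TwoAxis.Para.modulus; simp only [Skelφ.pt_zero, Skelφ.pt_one]; ring

/-- `Λ₁(yLof) = σ·(n_L d₁ − h_L d₀) + n_L·mh`. [folklore] -/
theorem Λ₁of_yLof (κ : Consts) {V : Type} [DecidableEq V] [Countable V] {G : SimpleGraph V} [G.LocallyFinite] (Φ : PlanarSkeletonFrm G) (t : V) (p : unitInterval) (D : Skelφ.StepI.DataNS V) (g : ℕ) (f : ℕ) (σ d₀ d₁ mh : ℤ) : Λ₁of κ Φ t p D g f (yLof κ Φ t p D g f σ d₀ d₁ mh) =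
    σ * ((nL κ Φ t p D g f : ℤ) * d₁ - hL κ Φ t p D g f * d₀) + (nL κ Φ t p D g f : ℤ) * mh := by
  unfold Λ₁of yLof; simp only [Skelφ.pt_zero, Skelφ.pt_one]; ring

/-- `|yLof|₁ ≤ n_L + |h_L| + |d₀| + |d₁| + |mh|`. [folklore] -/
theorem yLof_l1 (κ : Consts) {V : Type} [DecidableEq V] [Countable V] {G : SimpleGraph V} [G.LocallyFinite] (Φ : PlanarSkeletonFrm G) (t : V) (p : unitInterval) (D : Skelφ.StepI.DataNS V) (g : ℕ) (f : ℕ) {σ : ℤ} (hσ : σ = 1 ∨ σ = -1) (d₀ d₁ mh : ℤ) :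
    (yLof κ Φ t p D g f σ d₀ d₁ mh 0).natAbs + (yLof κ Φ t p D g f σ d₀ d₁ mh 1).natAbs ≤
      nL κ Φ t p D g f + (hL κ Φ t p D g f).natAbs + d₀.natAbs + d₁.natAbs + mh.natAbs := by
  have hσ' : |σ| = 1 := by rcases hσ with h | h <;> simp [h]
  have h0 : |yLof κ Φ t p D g f σ d₀ d₁ mh 0| ≤ (nL κ Φ t p D g f : ℤ) + |d₀| := by
    unfold yLof; rw [Skelφ.pt_zero, abs_mul, hσ', one_mul]
    exact (abs_add_le _ _).trans (by rw [Nat.abs_cast])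
  have h1 : |yLof κ Φ t p D g f σ d₀ d₁ mh 1| ≤ |hL κ Φ t p D g f| + |d₁| + |mh| := by
    unfold yLof; rw [Skelφ.pt_one]
    calc |σ * (hL κ Φ t p D g f + d₁) + mh| ≤ |σ * (hL κ Φ t p D g f + d₁)| + |mh| := abs_add_le _ _
      _ ≤ |hL κ Φ t p D g f| + |d₁| + |mh| := by rw [abs_mul, hσ', one_mul]; linarith [abs_add_le (hL κ Φ t p D g f) d₁]
  have e : (((yLof κ Φ t p D g f σ d₀ d₁ mh 0).natAbs + (yLof κ Φ t p D g f σ d₀ d₁ mh 1).natAbs : ℕ) : ℤ) ≤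
      ((nL κ Φ t p D g f + (hL κ Φ t p D g f).natAbs + d₀.natAbs + d₁.natAbs + mh.natAbs : ℕ) : ℤ) := by
    push_cast [Int.natCast_natAbs]; linarith
  exact_mod_cast e

end Generic

/-! ## §1 Sizes at the F pair and the origin readings -/

section Sizes

/-- **`|Λ₀(yLof)| ≤ 3m` and `|Λ₁(yLof)| ≤ 2m`** at `g := gT` whenever `|d₀|, |d₁| ≤ S_F := nBF + ℓBF + |hBF|` (the F twin of `abs_Λof_yLof_le`; floor `16·S_F ≤ M_L` as a hypothesis), `0 ≤ mh`, `2mh ≤ ℓ_L + S`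
(`16S ≤ M_L < n_L, ℓ_L`, `|v_β| ≤ ℓ_L + 10n_L + 1`, `|v_L| ≤ n_L`, `|h_L| ≤ 10n_L`, `m > n_L(ℓ_L − 1) ≥ 8n_L`). [folklore] -/
theorem abs_Λof_yLofF_le (κ : Consts) {V : Type} [DecidableEq V] [Countable V] {G : SimpleGraph V} [G.LocallyFinite] (Φ : PlanarSkeletonFrm G) (t : V) (p : unitInterval) (D : Skelφ.StepI.DataNS V) (c : ℕ) (mk : ℕ) (gx : Neg.FSlot) (f : ℕ) (hN : EqNumL κ Φ t p D (gT mk gx κ Φ t p D) f) (hκ : (hL κ Φ t p D (gT mk gx κ Φ t p D) f).natAbs ≤ 10 * nL κ Φ t p D (gT mk gx κ Φ t p D) f)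
    (hS : 16 * SF κ Φ t p D c mk ≤ ML κ Φ t p D (gT mk gx κ Φ t p D)) (hR0 : 22000 * (KS0.R'0 κ Φ t p D mk + 2) ≤ ML κ Φ t p D (gT mk gx κ Φ t p D)) {σ : ℤ} (hσ : σ = 1 ∨ σ = -1) {d₀ d₁ mh : ℤ}
    (hd₀ : |d₀| ≤ ((SF κ Φ t p D c mk : ℕ) : ℤ))
    (hd₁ : |d₁| ≤ ((SF κ Φ t p D c mk : ℕ) : ℤ)) (hmh : 0 ≤ mh)
    (hmh' : 2 * mh ≤ (ℓL κ Φ t p D (gT mk gx κ Φ t p D) f : ℤ) + ((SF κ Φ t p D c mk : ℕ) : ℤ)) :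
    |Λ₀of κ Φ t p D (gT mk gx κ Φ t p D) f (yLof κ Φ t p D (gT mk gx κ Φ t p D) f σ d₀ d₁ mh)| ≤
        3 * modulus (nL κ Φ t p D (gT mk gx κ Φ t p D) f) (hL κ Φ t p D (gT mk gx κ Φ t p D) f) (vL κ Φ t p D (gT mk gx κ Φ t p D) f)
          (Skelφ.NegPrm.vβOf (nL κ Φ t p D (gT mk gx κ Φ t p D) f) (hL κ Φ t p D (gT mk gx κ Φ t p D) f) (ℓL κ Φ t p D (gT mk gx κ Φ t p D) f) (vL κ Φ t p D (gT mk gx κ Φ t p D) f)) ∧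
      |Λ₁of κ Φ t p D (gT mk gx κ Φ t p D) f (yLof κ Φ t p D (gT mk gx κ Φ t p D) f σ d₀ d₁ mh)| ≤
        2 * modulus (nL κ Φ t p D (gT mk gx κ Φ t p D) f) (hL κ Φ t p D (gT mk gx κ Φ t p D) f) (vL κ Φ t p D (gT mk gx κ Φ t p D) f)
          (Skelφ.NegPrm.vβOf (nL κ Φ t p D (gT mk gx κ Φ t p D) f) (hL κ Φ t p D (gT mk gx κ Φ t p D) f) (ℓL κ Φ t p D (gT mk gx κ Φ t p D) f) (vL κ Φ t p D (gT mk gx κ Φ t p D) f)) := by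
  obtain ⟨hn1, hℓ1⟩ := one_le_of_eqNumL κ Φ t p D _ f hN
  have hvβ := abs_vβL_le κ Φ t p D _ f hN hκ
  have hv : |vL κ Φ t p D (gT mk gx κ Φ t p D) f| ≤ nL κ Φ t p D (gT mk gx κ Φ t p D) f := hN.v_le
  have hMn := hN.n_le
  have hMℓ := hN.ℓ_le
  have hm := (Skelφ.NegPrm.modulus_vβOf hn1 (hL κ Φ t p D (gT mk gx κ Φ t p D) f) (ℓL κ Φ t p D (gT mk gx κ Φ t p D) f) (vL κ Φ t p D (gT mk gx κ Φ t p D) f)).1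
  have hκ' : |hL κ Φ t p D (gT mk gx κ Φ t p D) f| ≤ 10 * (nL κ Φ t p D (gT mk gx κ Φ t p D) f : ℤ) := by rw [← Int.natCast_natAbs]; exact_mod_cast hκ
  have hS16 : 16 * (((SF κ Φ t p D c mk : ℕ) : ℤ)) ≤ (ML κ Φ t p D (gT mk gx κ Φ t p D) : ℤ) := by
    have h' : ((16 * SF κ Φ t p D c mk : ℕ) : ℤ) ≤ (ML κ Φ t p D (gT mk gx κ Φ t p D) : ℤ) := by exact_mod_cast hS
    simpa only [Nat.cast_mul, Nat.cast_ofNat] using h'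
  have h22 : 22000 * ((KS0.R'0 κ Φ t p D mk : ℤ) + 2) ≤ (ML κ Φ t p D (gT mk gx κ Φ t p D) : ℤ) := by
    have h' : ((22000 * (KS0.R'0 κ Φ t p D mk + 2) : ℕ) : ℤ) ≤ (ML κ Φ t p D (gT mk gx κ Φ t p D) : ℤ) := by exact_mod_cast hR0
    push_cast at h'; exact h'
  have hσ' : |σ| = 1 := by rcases hσ with h | h <;> simp [h]
  rw [Λ₀of_yLof, Λ₁of_yLof]
  have e : vβL κ Φ t p D (gT mk gx κ Φ t p D) f =
      Skelφ.NegPrm.vβOf (nL κ Φ t p D (gT mk gx κ Φ t p D) f) (hL κ Φ t p D (gT mk gx κ Φ t p D) f) (ℓL κ Φ t p D (gT mk gx κ Φ t p D) f) (vL κ Φ t p D (gT mk gx κ Φ t p D) f) := rfl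
  rw [← e] at hm ⊢
  generalize modulus (nL κ Φ t p D (gT mk gx κ Φ t p D) f) (hL κ Φ t p D (gT mk gx κ Φ t p D) f) (vL κ Φ t p D (gT mk gx κ Φ t p D) f) (vβL κ Φ t p D (gT mk gx κ Φ t p D) f) = m at hm ⊢
  generalize ((SF κ Φ t p D c mk : ℕ) : ℤ) = S at hd₀ hd₁ hmh' hS16
  generalize (nL κ Φ t p D (gT mk gx κ Φ t p D) f : ℤ) = n at hn1 hvβ hv hMn hm hκ' ⊢
  generalize (ℓL κ Φ t p D (gT mk gx κ Φ t p D) f : ℤ) = ℓ at hℓ1 hvβ hMℓ hm hmh' ⊢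
  generalize (ML κ Φ t p D (gT mk gx κ Φ t p D) : ℤ) = M at hMn hMℓ hS16 h22
  generalize vβL κ Φ t p D (gT mk gx κ Φ t p D) f = vβ at hvβ ⊢
  generalize vL κ Φ t p D (gT mk gx κ Φ t p D) f = vα at hv ⊢
  generalize hL κ Φ t p D (gT mk gx κ Φ t p D) f = hh at hκ' ⊢
  have hR0 : (0 : ℤ) ≤ (KS0.R'0 κ Φ t p D mk : ℤ) := by positivity
  have hS0 : 0 ≤ S := le_trans (abs_nonneg _) hd₀
  have hn0 : (0 : ℤ) ≤ n := by linarith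
  have hℓ9 : (9 : ℤ) ≤ ℓ := by linarith
  have hm0 : 0 < m := by nlinarith
  -- the products
  have p1 : |vβ * d₀| ≤ (ℓ + 10 * n + 1) * S := by rw [abs_mul]; exact mul_le_mul hvβ hd₀ (abs_nonneg _) (by linarith [abs_nonneg vβ])
  have p2 : |vα * d₁| ≤ n * S := by rw [abs_mul]; exact mul_le_mul hv hd₁ (abs_nonneg _) hn0
  have p3 : |vα * mh| ≤ n * mh := by rw [abs_mul, abs_of_nonneg hmh]; exact mul_le_mul_of_nonneg_right hv hmh
  have p4 : |n * d₁| ≤ n * S := by rw [abs_mul, abs_of_nonneg hn0]; exact mul_le_mul_of_nonneg_left hd₁ hn0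
  have p5 : |hh * d₀| ≤ 10 * n * S := by rw [abs_mul]; exact mul_le_mul hκ' hd₀ (abs_nonneg _) (by positivity)
  -- `16S ≤ n − 1`, `16S ≤ ℓ − 1`
  have q1 : (ℓ + 1) * (16 * S) ≤ (ℓ + 1) * (n - 1) := mul_le_mul_of_nonneg_left (by linarith) (by linarith)
  have q2 : n * (16 * S) ≤ n * (ℓ - 1) := mul_le_mul_of_nonneg_left (by linarith) hn0
  have q3 : n * (2 * mh) ≤ n * (ℓ + S) := mul_le_mul_of_nonneg_left hmh' hn0
  have q4 : n * 8 ≤ n * (ℓ - 1) := mul_le_mul_of_nonneg_left (by linarith) hn0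
  have a1 : |σ * m| = m := by rw [abs_mul, hσ', one_mul, abs_of_pos hm0]
  have a2 : |σ * (vβ * d₀ - vα * d₁)| ≤ (ℓ + 10 * n + 1) * S + n * S := by
    rw [abs_mul, hσ', one_mul]; exact (abs_sub _ _).trans (add_le_add p1 p2)
  have a3 : |σ * (n * d₁ - hh * d₀)| ≤ n * S + 10 * n * S := by
    rw [abs_mul, hσ', one_mul]; exact (abs_sub _ _).trans (add_le_add p4 p5)
  constructor
  · calc |σ * m + σ * (vβ * d₀ - vα * d₁) - vα * mh| ≤ |σ * m + σ * (vβ * d₀ - vα * d₁)| + |vα * mh| := abs_sub _ _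
      _ ≤ |σ * m| + |σ * (vβ * d₀ - vα * d₁)| + |vα * mh| := by linarith [abs_add_le (σ * m) (σ * (vβ * d₀ - vα * d₁))]
      _ ≤ m + ((ℓ + 10 * n + 1) * S + n * S) + n * mh := by rw [a1]; linarith
      _ ≤ 3 * m := by nlinarith
  · have a4 : |n * mh| = n * mh := by rw [abs_mul, abs_of_nonneg hn0, abs_of_nonneg hmh]
    calc |σ * (n * d₁ - hh * d₀) + n * mh| ≤ |σ * (n * d₁ - hh * d₀)| + |n * mh| := abs_add_le _ _
      _ ≤ (n * S + 10 * n * S) + n * mh := by rw [a4]; linarith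
      _ ≤ 2 * m := by nlinarith

end Sizes

section Readings

/-- **The along reading from the Λ₀-size**: `|Λ₀ y| ≤ k·m ⇒ |FcA y| ≤ k·u₀A` (`FcA y = ⌊(2u₀Λ₀ y + m)/(2m)⌋`). [folklore] -/
theorem abs_FcA_le_of_Λ₀ (κ : Consts) {V : Type} [DecidableEq V] [Countable V] {G : SimpleGraph V} [G.LocallyFinite] (Φ : PlanarSkeletonFrm G) (t : V) (p : unitInterval) (D : Skelφ.StepI.DataNS V) (g : ℕ) (f : ℕ) (hN : EqNumL κ Φ t p D g f) {k : ℤ} (y : Site 2)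
    (hy : |Λ₀of κ Φ t p D g f y| ≤ k * modulus (nL κ Φ t p D g f) (hL κ Φ t p D g f) (vL κ Φ t p D g f) (vβL κ Φ t p D g f)) :
    |FcA κ Φ t p D g f y| ≤ k * u₀A κ Φ t p D g f := by
  obtain ⟨hn1, hℓ1⟩ := one_le_of_eqNumL κ Φ t p D g f hN
  have hm : 0 < modulus (nL κ Φ t p D g f) (hL κ Φ t p D g f) (vL κ Φ t p D g f) (vβL κ Φ t p D g f) := Skelφ.NegPrm.modulus_vβOf_pos hn1 hℓ1 _ _
  have hu : 1 ≤ u₀A κ Φ t p D g f := (units_eqA κ Φ t p D g f).2.2.2.2.1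
  rw [FcA_eq]
  generalize modulus (nL κ Φ t p D g f) (hL κ Φ t p D g f) (vL κ Φ t p D g f) (vβL κ Φ t p D g f) = m at hm hy ⊢
  generalize u₀A κ Φ t p D g f = u at hu ⊢
  generalize Λ₀of κ Φ t p D g f y = Λ at hy
  obtain ⟨hy1, hy2⟩ := abs_le.1 hy
  have hKu : -(k * u) * m ≤ u * Λ ∧ u * Λ ≤ (k * u) * m := by
    constructor <;> nlinarith [mul_le_mul_of_nonneg_left hy1 (by linarith : (0:ℤ) ≤ u), mul_le_mul_of_nonneg_left hy2 (by linarith : (0:ℤ) ≤ u)]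
  generalize k * u = K at hKu ⊢
  have h2m : (2 * m) ≠ 0 := by positivity
  have d1 := Int.mul_ediv_self_le (x := 2 * u * Λ + m) h2m
  have d2 := Int.lt_mul_ediv_self_add (x := 2 * u * Λ + m) (k := 2 * m) (by positivity)
  generalize (2 * u * Λ + m) / (2 * m) = q at d1 d2 ⊢
  rw [abs_le]
  constructor
  · by_contra hc
    have : q + 1 ≤ -K := by omega
    nlinarith
  · by_contra hc
    have : K + 1 ≤ q := by omega
    nlinarith

/-- **The tangential reading from the Λ₁-size**: `|Λ₁ y| ≤ k·m ⇒ |F1cA y| ≤ k·u₁A`. [folklore] -/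
theorem abs_F1cA_le_of_Λ₁ (κ : Consts) {V : Type} [DecidableEq V] [Countable V] {G : SimpleGraph V} [G.LocallyFinite] (Φ : PlanarSkeletonFrm G) (t : V) (p : unitInterval) (D : Skelφ.StepI.DataNS V) (g : ℕ) (f : ℕ) (hN : EqNumL κ Φ t p D g f) {k : ℤ} (y : Site 2)
    (hy : |Λ₁of κ Φ t p D g f y| ≤ k * modulus (nL κ Φ t p D g f) (hL κ Φ t p D g f) (vL κ Φ t p D g f) (vβL κ Φ t p D g f)) :
    |F1cA κ Φ t p D g f y| ≤ k * u₁A κ Φ t p D g f := by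
  obtain ⟨hn1, hℓ1⟩ := one_le_of_eqNumL κ Φ t p D g f hN
  have hm : 0 < modulus (nL κ Φ t p D g f) (hL κ Φ t p D g f) (vL κ Φ t p D g f) (vβL κ Φ t p D g f) := Skelφ.NegPrm.modulus_vβOf_pos hn1 hℓ1 _ _
  have hu : 1 ≤ u₁A κ Φ t p D g f := (units_eqA κ Φ t p D g f).2.2.2.2.2
  rw [F1cA_eq]
  generalize modulus (nL κ Φ t p D g f) (hL κ Φ t p D g f) (vL κ Φ t p D g f) (vβL κ Φ t p D g f) = m at hm hy ⊢
  generalize u₁A κ Φ t p D g f = u at hu ⊢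
  generalize Λ₁of κ Φ t p D g f y = Λ at hy
  obtain ⟨hy1, hy2⟩ := abs_le.1 hy
  have hKu : -(k * u) * m ≤ u * Λ ∧ u * Λ ≤ (k * u) * m := by
    constructor <;> nlinarith [mul_le_mul_of_nonneg_left hy1 (by linarith : (0:ℤ) ≤ u), mul_le_mul_of_nonneg_left hy2 (by linarith : (0:ℤ) ≤ u)]
  generalize k * u = K at hKu ⊢
  have h2m : (2 * m) ≠ 0 := by positivity
  have d1 := Int.mul_ediv_self_le (x := 2 * u * Λ + m) h2m
  have d2 := Int.lt_mul_ediv_self_add (x := 2 * u * Λ + m) (k := 2 * m) (by positivity)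
  generalize (2 * u * Λ + m) / (2 * m) = q at d1 d2 ⊢
  rw [abs_le]
  constructor
  · by_contra hc
    have : q + 1 ≤ -K := by omega
    nlinarith
  · by_contra hc
    have : K + 1 ≤ q := by omega
    nlinarith

/-- **The skeleton's along-origin premise `he0`**: `|Λ₀ yL| ≤ 3m ⇒ |FcA (yTX0 yL σT)| ≤ 6·u₀A` (`|FcA yL| ≤ 3u₀A`, cross shift `≤ u₀A + 2`, `u₀A ≥ 1`). [folklore] -/
theorem he0_of_Λ₀ (κ : Consts) {V : Type} [DecidableEq V] [Countable V] {G : SimpleGraph V} [G.LocallyFinite] (Φ : PlanarSkeletonFrm G) (t : V) (p : unitInterval) (D : Skelφ.StepI.DataNS V) (g : ℕ) (f : ℕ) (hN : EqNumL κ Φ t p D g f) (yL : Site 2)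
    (hy : |Λ₀of κ Φ t p D g f yL| ≤ 3 * modulus (nL κ Φ t p D g f) (hL κ Φ t p D g f) (vL κ Φ t p D g f) (vβL κ Φ t p D g f)) {σT : ℤ} (hσT : σT = 1 ∨ σT = -1) :
    |FcA κ Φ t p D g f (yTX0 κ Φ t p D g f yL σT)| ≤ 6 * u₀A κ Φ t p D g f := by
  have h1 := abs_FcA_le_of_Λ₀ κ Φ t p D g f hN yL hy
  have h2 := FcA_yTX0_sub_abs_le κ Φ t p D g f hN yL hσT
  have hu : 1 ≤ u₀A κ Φ t p D g f := (units_eqA κ Φ t p D g f).2.2.2.2.1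
  have h3 := abs_add_le (FcA κ Φ t p D g f (yTX0 κ Φ t p D g f yL σT) - FcA κ Φ t p D g f yL) (FcA κ Φ t p D g f yL)
  rw [sub_add_cancel] at h3
  linarith

/-- **The skeleton's tangential-origin premise `he1`**: `|Λ₁ yL| ≤ 2m ⇒ |F1cA yL| ≤ 6·u₁A`. [folklore] -/
theorem he1_of_Λ₁ (κ : Consts) {V : Type} [DecidableEq V] [Countable V] {G : SimpleGraph V} [G.LocallyFinite] (Φ : PlanarSkeletonFrm G) (t : V) (p : unitInterval) (D : Skelφ.StepI.DataNS V) (g : ℕ) (f : ℕ) (hN : EqNumL κ Φ t p D g f) (yL : Site 2)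
    (hy : |Λ₁of κ Φ t p D g f yL| ≤ 2 * modulus (nL κ Φ t p D g f) (hL κ Φ t p D g f) (vL κ Φ t p D g f) (vβL κ Φ t p D g f)) :
    |F1cA κ Φ t p D g f yL| ≤ 6 * u₁A κ Φ t p D g f := by
  have h1 := abs_F1cA_le_of_Λ₁ κ Φ t p D g f hN yL hy
  have hu : 1 ≤ u₁A κ Φ t p D g f := (units_eqA κ Φ t p D g f).2.2.2.2.2
  linarith

end Readings

/-! ## §2 Case `o_b = o_L` (`KS.BFs σ`): the x-face origin, half-width, readings -/

section Same

/-- The transverse midpoint of the F bridge's core `1`, case same: `⌊(ℓ_L + ℓBF)/2⌋`. [this work] -/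
def mhXFs (κ : Consts) {V : Type} [DecidableEq V] [Countable V] {G : SimpleGraph V} [G.LocallyFinite] (Φ : PlanarSkeletonFrm G) (t : V) (p : unitInterval) (D : Skelφ.StepI.DataNS V) (c : ℕ) (mk : ℕ) (g : ℕ) (f : ℕ) : ℤ := ((ℓL κ Φ t p D g f : ℤ) + ℓBF κ Φ t p D c mk) / 2

/-- **The x-face run origin, case same**: `yLXFs σ := (σ(n_L + nBF), σ(h_L + hBF) + ⌊(ℓ_L + ℓBF)/2⌋)` (centre of `KS.BFs σ`'s core `1`). [this work] -/
def yLXFs (κ : Consts) {V : Type} [DecidableEq V] [Countable V] {G : SimpleGraph V} [G.LocallyFinite] (Φ : PlanarSkeletonFrm G) (t : V) (p : unitInterval) (D : Skelφ.StepI.DataNS V) (c : ℕ) (mk : ℕ) (g : ℕ) (f : ℕ) (σ : ℤ) : Site 2 := yLof κ Φ t p D g f σ (nBF κ Φ t p D c mk) (hBF κ Φ t p D c mk) (mhXFs κ Φ t p D c mk g f)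

/-- **The x-face start half-width, case same**: `qBXFs := RA′`. [this work] -/
def qBXFs (κ : Consts) {V : Type} [DecidableEq V] [Countable V] {G : SimpleGraph V} [G.LocallyFinite] (Φ : PlanarSkeletonFrm G) (t : V) (p : unitInterval) (D : Skelφ.StepI.DataNS V) (mk : ℕ) : ℕ := KS0.R'0 κ Φ t p D mk

/-- `σ·yLXFs₀ = n_L + nBF`. [folklore] -/
theorem yLXFs_zero (κ : Consts) {V : Type} [DecidableEq V] [Countable V] {G : SimpleGraph V} [G.LocallyFinite] (Φ : PlanarSkeletonFrm G) (t : V) (p : unitInterval) (D : Skelφ.StepI.DataNS V) (c : ℕ) (mk : ℕ) (g : ℕ) (f : ℕ) {σ : ℤ} (hσ : σ = 1 ∨ σ = -1) : σ * yLXFs κ Φ t p D c mk g f σ 0 = (nL κ Φ t p D g f : ℤ) + nBF κ Φ t p D c mk := by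
  have hσsq : σ * σ = 1 := by rcases hσ with h | h <;> simp [h]
  unfold yLXFs yLof; rw [Skelφ.pt_zero, ← mul_assoc, hσsq, one_mul]

/-- **`hxa`, x-face, case same**: `|x₀ − σ·yL₀| ≤ qBXFs` on `KS.BFs σ`'s core `1`. [folklore] -/
theorem hxaXF_s (κ : Consts) {V : Type} [DecidableEq V] [Countable V] {G : SimpleGraph V} [G.LocallyFinite] (Φ : PlanarSkeletonFrm G) (t : V) (p : unitInterval) (D : Skelφ.StepI.DataNS V) (c : ℕ) (mk : ℕ) (g : ℕ) (f : ℕ) {σ : ℤ} (hσ : σ = 1 ∨ σ = -1) :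
    ∀ x ∈ Finset.Icc (BFs κ Φ t p D c mk g f σ).core1Lo (BFs κ Φ t p D c mk g f σ).core1Hi, |x 0 - σ * yLXFs κ Φ t p D c mk g f σ 0| ≤ (qBXFs κ Φ t p D mk : ℤ) := by
  intro x hx
  rw [BFs, mem_core1F_same_iff] at hx
  rw [yLXFs_zero κ Φ t p D c mk g f hσ, abs_le]; unfold qBXFs; constructor <;> linarith [hx.1.1, hx.1.2]

/-- **p1's clearance premise `hyL` at the x-face origin, case same**: `M_u < σ·yL₀ − qBXFs − RA′ − n_L` (`= nBF − 2RA′`; `clearF`). [folklore] -/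
theorem hyL_XFs (κ : Consts) {V : Type} [DecidableEq V] [Countable V] {G : SimpleGraph V} [G.LocallyFinite] (Φ : PlanarSkeletonFrm G) (t : V) (p : unitInterval) (D : Skelφ.StepI.DataNS V) (c : ℕ) (mk : ℕ) (g : ℕ) (f : ℕ) {σ : ℤ} (hσ : σ = 1 ∨ σ = -1) :
    ((Mu D : ℕ) : ℤ) < σ * yLXFs κ Φ t p D c mk g f σ 0 - (qBXFs κ Φ t p D mk : ℤ) - KS0.R'0 κ Φ t p D mk - nL κ Φ t p D g f := by
  rw [yLXFs_zero κ Φ t p D c mk g f hσ]; unfold qBXFs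
  have h := clearF κ Φ t p D c mk
  have hR : (0 : ℤ) ≤ (c : ℤ) * (KS0.R'0 κ Φ t p D mk : ℤ) := by positivity
  nlinarith

/-- **`|Λ₀(yLXFs σ)| ≤ 3m` and `|Λ₁(yLXFs σ)| ≤ 2m`** at `g := gT` (floor `16·S_F ≤ M_L`). [folklore] -/
theorem Λ_yLXFs (κ : Consts) {V : Type} [DecidableEq V] [Countable V] {G : SimpleGraph V} [G.LocallyFinite] (Φ : PlanarSkeletonFrm G) (t : V) (p : unitInterval) (D : Skelφ.StepI.DataNS V) (c : ℕ) (mk : ℕ) (f : ℕ) (gx : Neg.FSlot) (hN : EqNumL κ Φ t p D (gT mk gx κ Φ t p D) f) (hκ : (hL κ Φ t p D (gT mk gx κ Φ t p D) f).natAbs ≤ 10 * nL κ Φ t p D (gT mk gx κ Φ t p D) f)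
    (hS : 16 * SF κ Φ t p D c mk ≤ ML κ Φ t p D (gT mk gx κ Φ t p D)) (hR0 : 22000 * (KS0.R'0 κ Φ t p D mk + 2) ≤ ML κ Φ t p D (gT mk gx κ Φ t p D)) {σ : ℤ} (hσ : σ = 1 ∨ σ = -1) :
    |Λ₀of κ Φ t p D (gT mk gx κ Φ t p D) f (yLXFs κ Φ t p D c mk (gT mk gx κ Φ t p D) f σ)| ≤
        3 * modulus (nL κ Φ t p D (gT mk gx κ Φ t p D) f) (hL κ Φ t p D (gT mk gx κ Φ t p D) f) (vL κ Φ t p D (gT mk gx κ Φ t p D) f) (vβL κ Φ t p D (gT mk gx κ Φ t p D) f) ∧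
      |Λ₁of κ Φ t p D (gT mk gx κ Φ t p D) f (yLXFs κ Φ t p D c mk (gT mk gx κ Φ t p D) f σ)| ≤
        2 * modulus (nL κ Φ t p D (gT mk gx κ Φ t p D) f) (hL κ Φ t p D (gT mk gx κ Φ t p D) f) (vL κ Φ t p D (gT mk gx κ Φ t p D) f) (vβL κ Φ t p D (gT mk gx κ Φ t p D) f) := by
  have hSe : ((SF κ Φ t p D c mk : ℕ) : ℤ) = (nBF κ Φ t p D c mk : ℤ) + ℓBF κ Φ t p D c mk + |hBF κ Φ t p D c mk| := by
    unfold SF; push_cast [Int.natCast_natAbs]; ring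
  have hd₀ : |(nBF κ Φ t p D c mk : ℤ)| ≤ ((SF κ Φ t p D c mk : ℕ) : ℤ) := by rw [hSe, Nat.abs_cast]; linarith [abs_nonneg (hBF κ Φ t p D c mk)]
  have hd₁ : |hBF κ Φ t p D c mk| ≤ ((SF κ Φ t p D c mk : ℕ) : ℤ) := by rw [hSe]; linarith
  obtain ⟨m1, m2⟩ := PlanarSkeletonNeg.NegB.RootArith.floor_sandwich (x := (ℓL κ Φ t p D (gT mk gx κ Φ t p D) f : ℤ) + ℓBF κ Φ t p D c mk) (d := 2) (by norm_num)
  have hmh : 0 ≤ mhXFs κ Φ t p D c mk (gT mk gx κ Φ t p D) f := by unfold mhXFs; omega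
  have hmh' : 2 * mhXFs κ Φ t p D c mk (gT mk gx κ Φ t p D) f ≤ (ℓL κ Φ t p D (gT mk gx κ Φ t p D) f : ℤ) + ((SF κ Φ t p D c mk : ℕ) : ℤ) := by
    unfold mhXFs; rw [hSe]; linarith [abs_nonneg (hBF κ Φ t p D c mk)]
  exact abs_Λof_yLofF_le κ Φ t p D c mk gx f hN hκ hS hR0 hσ hd₀ hd₁ hmh hmh'  -- `vβL = vβOf …` is `rfl`

end Same

section SameT

/-- **G-fit's premise `4·qB ≤ n_L`** at `qBXFs` (from the (F) floor `2000·Kq·(R'0+2) ≤ n_L`). [folklore] -/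
theorem four_qBXFs_le (κ : Consts) {V : Type} [DecidableEq V] [Countable V] {G : SimpleGraph V} [G.LocallyFinite] (Φ : PlanarSkeletonFrm G) (t : V) (p : unitInterval) (D : Skelφ.StepI.DataNS V) (mk : ℕ) (gx : Neg.FSlot) (fx : Neg.FSlot)
    (hnA : 2000 * Neg.Kq κ * (KS0.R'0 κ Φ t p D mk + 2) ≤ nL κ Φ t p D (gT mk gx κ Φ t p D) (fT mk fx κ Φ t p D)) :
    4 * qBXFs κ Φ t p D mk ≤ nL κ Φ t p D (gT mk gx κ Φ t p D) (fT mk fx κ Φ t p D) := by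
  have hq := Neg.one_le_Kq κ
  have h2 : KS0.R'0 κ Φ t p D mk + 2 ≤ Neg.Kq κ * (KS0.R'0 κ Φ t p D mk + 2) := Nat.le_mul_of_pos_left _ hq
  unfold qBXFs; nlinarith [h2, hnA]

/-- **`hxb`, x-face, case same**: the F bridge's core `1` lies in the run's start window (`ℓBF + 22RA′ + 23 ≤ ℓ_L`, from `16·S_F ≤ M_L`). [folklore] -/
theorem hxbXF_s (κ : Consts) {V : Type} [DecidableEq V] [Countable V] {G : SimpleGraph V} [G.LocallyFinite] (Φ : PlanarSkeletonFrm G) (t : V) (p : unitInterval) (D : Skelφ.StepI.DataNS V) (c : ℕ) (mk : ℕ) (gx : Neg.FSlot) (fx : Neg.FSlot) (hN : EqNumL κ Φ t p D (gT mk gx κ Φ t p D) (fT mk fx κ Φ t p D)) (hκ : (hL κ Φ t p D (gT mk gx κ Φ t p D) (fT mk fx κ Φ t p D)).natAbs ≤ 10 * nL κ Φ t p D (gT mk gx κ Φ t p D) (fT mk fx κ Φ t p D))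
    (hS : 16 * SF κ Φ t p D c mk ≤ ML κ Φ t p D (gT mk gx κ Φ t p D)) (hR0 : 22000 * (KS0.R'0 κ Φ t p D mk + 2) ≤ ML κ Φ t p D (gT mk gx κ Φ t p D)) {σ : ℤ} (hσ : σ = 1 ∨ σ = -1) :
    ∀ x ∈ Finset.Icc (Skelφ.bridgeSame σ (nL κ Φ t p D (gT mk gx κ Φ t p D) (fT mk fx κ Φ t p D)) (hL κ Φ t p D (gT mk gx κ Φ t p D) (fT mk fx κ Φ t p D)) (ℓL κ Φ t p D (gT mk gx κ Φ t p D) (fT mk fx κ Φ t p D)) (KS0.R'0 κ Φ t p D mk) (nBF κ Φ t p D c mk) (hBF κ Φ t p D c mk) (ℓBF κ Φ t p D c mk)).core1Lo (Skelφ.bridgeSame σ (nL κ Φ t p D (gT mk gx κ Φ t p D) (fT mk fx κ Φ t p D)) (hL κ Φ t p D (gT mk gx κ Φ t p D) (fT mk fx κ Φ t p D)) (ℓL κ Φ t p D (gT mk gx κ Φ t p D) (fT mk fx κ Φ t p D)) (KS0.R'0 κ Φ t p D mk) (nBF κ Φ t p D c mk) (hBF κ Φ t p D c mk) (ℓBF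 κ Φ t p D c mk)).core1Hi,
      |σ * ((nL κ Φ t p D (gT mk gx κ Φ t p D) (fT mk fx κ Φ t p D) : ℤ) * (x 1 - yLXFs κ Φ t p D c mk (gT mk gx κ Φ t p D) (fT mk fx κ Φ t p D) σ 1) - hL κ Φ t p D (gT mk gx κ Φ t p D) (fT mk fx κ Φ t p D) * (σ * x 0 - yLXFs κ Φ t p D c mk (gT mk gx κ Φ t p D) (fT mk fx κ Φ t p D) σ 0))| + (shearUnit (nL κ Φ t p D (gT mk gx κ Φ t p D) (fT mk fx κ Φ t p D)) (hL κ Φ t p D (gT mk gx κ Φ t p D) (fT mk fx κ Φ t p D)) : ℤ) ≤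
        ((nL κ Φ t p D (gT mk gx κ Φ t p D) (fT mk fx κ Φ t p D) * ℓL κ Φ t p D (gT mk gx κ Φ t p D) (fT mk fx κ Φ t p D) / shearUnit (nL κ Φ t p D (gT mk gx κ Φ t p D) (fT mk fx κ Φ t p D)) (hL κ Φ t p D (gT mk gx κ Φ t p D) (fT mk fx κ Φ t p D)) + 1 : ℕ) : ℤ) * (shearUnit (nL κ Φ t p D (gT mk gx κ Φ t p D) (fT mk fx κ Φ t p D)) (hL κ Φ t p D (gT mk gx κ Φ t p D) (fT mk fx κ Φ t p D)) : ℤ) := by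
  intro x hx
  rw [mem_core1F_same_iff] at hx
  obtain ⟨⟨h0l, h0u⟩, ⟨h1l, h1u⟩⟩ := hx
  obtain ⟨hn1, hℓ1⟩ := one_le_of_eqNumL κ Φ t p D _ _ hN
  have hσsq : σ * σ = 1 := by rcases hσ with h | h <;> simp [h]
  have hσabs : |σ| = 1 := by rcases hσ with h | h <;> simp [h]
  have hW := (Wrun_spec κ Φ t p D (gT mk gx κ Φ t p D) (fT mk fx κ Φ t p D) hn1).1
  unfold Wrun at hW
  have hU : (shearUnit (nL κ Φ t p D (gT mk gx κ Φ t p D) (fT mk fx κ Φ t p D)) (hL κ Φ t p D (gT mk gx κ Φ t p D) (fT mk fx κ Φ t p D)) : ℤ) ≤ 11 * (nL κ Φ t p D (gT mk gx κ Φ t p D) (fT mk fx κ Φ t p D) : ℤ) := by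
    have h10 : ((hL κ Φ t p D (gT mk gx κ Φ t p D) (fT mk fx κ Φ t p D)).natAbs : ℤ) ≤ 10 * (nL κ Φ t p D (gT mk gx κ Φ t p D) (fT mk fx κ Φ t p D) : ℤ) := by exact_mod_cast hκ
    unfold Skelφ.shearUnit; simp only [Nat.cast_add]; linarith
  have hκ' : |hL κ Φ t p D (gT mk gx κ Φ t p D) (fT mk fx κ Φ t p D)| ≤ 10 * (nL κ Φ t p D (gT mk gx κ Φ t p D) (fT mk fx κ Φ t p D) : ℤ) := by rw [← Int.natCast_natAbs]; exact_mod_cast hκ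
  -- the floor `ℓ_b + 22RA′ + 23 ≤ ℓ_L`
  have hfl : (ℓBF κ Φ t p D c mk : ℤ) + 22 * KS0.R'0 κ Φ t p D mk + 23 ≤ ℓL κ Φ t p D (gT mk gx κ Φ t p D) (fT mk fx κ Φ t p D) := by
    have h3 : ℓBF κ Φ t p D c mk ≤ SF κ Φ t p D c mk := by unfold SF; omega
    have h4 : 22000 * (KS0.R'0 κ Φ t p D mk + 2) ≤ ML κ Φ t p D (gT mk gx κ Φ t p D) := hR0
    have h5 := hN.ℓ_le
    have h6 : ((ℓBF κ Φ t p D c mk + 22 * KS0.R'0 κ Φ t p D mk + 23 : ℕ) : ℤ) ≤ (ML κ Φ t p D (gT mk gx κ Φ t p D) : ℤ) := by exact_mod_cast (by omega : ℓBF κ Φ t p D c mk + 22 * KS0.R'0 κ Φ t p D mk + 23 ≤ ML κ Φ t p D (gT mk gx κ Φ t p D))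
    push_cast at h6; linarith
  -- the origin's coordinates
  have e0 : σ * x 0 - yLXFs κ Φ t p D c mk (gT mk gx κ Φ t p D) (fT mk fx κ Φ t p D) σ 0 = σ * (x 0 - ((nL κ Φ t p D (gT mk gx κ Φ t p D) (fT mk fx κ Φ t p D) : ℤ) + nBF κ Φ t p D c mk)) := by
    unfold yLXFs yLof; rw [Skelφ.pt_zero]; ring
  have e1 : yLXFs κ Φ t p D c mk (gT mk gx κ Φ t p D) (fT mk fx κ Φ t p D) σ 1 = σ * (hL κ Φ t p D (gT mk gx κ Φ t p D) (fT mk fx κ Φ t p D) + hBF κ Φ t p D c mk) + mhXFs κ Φ t p D c mk (gT mk gx κ Φ t p D) (fT mk fx κ Φ t p D) := by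
    unfold yLXFs yLof; rw [Skelφ.pt_one]
  obtain ⟨m1, m2⟩ := PlanarSkeletonNeg.NegB.RootArith.floor_sandwich (x := (ℓL κ Φ t p D (gT mk gx κ Φ t p D) (fT mk fx κ Φ t p D) : ℤ) + ℓBF κ Φ t p D c mk) (d := 2) (by norm_num)
  have em : mhXFs κ Φ t p D c mk (gT mk gx κ Φ t p D) (fT mk fx κ Φ t p D) = ((ℓL κ Φ t p D (gT mk gx κ Φ t p D) (fT mk fx κ Φ t p D) : ℤ) + ℓBF κ Φ t p D c mk) / 2 := rfl
  rw [← em] at m1 m2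
  set a := x 1 - yLXFs κ Φ t p D c mk (gT mk gx κ Φ t p D) (fT mk fx κ Φ t p D) σ 1 with ha
  set b := x 0 - ((nL κ Φ t p D (gT mk gx κ Φ t p D) (fT mk fx κ Φ t p D) : ℤ) + nBF κ Φ t p D c mk) with hb
  have hb' : |b| ≤ KS0.R'0 κ Φ t p D mk := abs_le.2 ⟨by rw [hb]; linarith, by rw [hb]; linarith⟩
  have ha' : |2 * a| ≤ (ℓL κ Φ t p D (gT mk gx κ Φ t p D) (fT mk fx κ Φ t p D) : ℤ) + ℓBF κ Φ t p D c mk + 2 * KS0.R'0 κ Φ t p D mk + 1 := by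
    rw [ha, e1, abs_le]; constructor <;> linarith
  rw [e0]
  have key : |σ * ((nL κ Φ t p D (gT mk gx κ Φ t p D) (fT mk fx κ Φ t p D) : ℤ) * a - hL κ Φ t p D (gT mk gx κ Φ t p D) (fT mk fx κ Φ t p D) * (σ * b))| ≤ (nL κ Φ t p D (gT mk gx κ Φ t p D) (fT mk fx κ Φ t p D) : ℤ) * |a| + |hL κ Φ t p D (gT mk gx κ Φ t p D) (fT mk fx κ Φ t p D)| * |b| := by
    rw [abs_mul, hσabs, one_mul]
    calc |(nL κ Φ t p D (gT mk gx κ Φ t p D) (fT mk fx κ Φ t p D) : ℤ) * a - hL κ Φ t p D (gT mk gx κ Φ t p D) (fT mk fx κ Φ t p D) * (σ * b)| ≤ |(nL κ Φ t p D (gT mk gx κ Φ t p D) (fT mk fx κ Φ t p D) : ℤ) * a| + |hL κ Φ t p D (gT mk gx κ Φ t p D) (fT mk fx κ Φ t p D) * (σ * b)| := abs_sub _ _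
      _ = (nL κ Φ t p D (gT mk gx κ Φ t p D) (fT mk fx κ Φ t p D) : ℤ) * |a| + |hL κ Φ t p D (gT mk gx κ Φ t p D) (fT mk fx κ Φ t p D)| * |b| := by rw [abs_mul, abs_mul, abs_mul, hσabs, one_mul, Nat.abs_cast]
  have hn0 : (0 : ℤ) ≤ nL κ Φ t p D (gT mk gx κ Φ t p D) (fT mk fx κ Φ t p D) := by positivity
  have h2a : 2 * ((nL κ Φ t p D (gT mk gx κ Φ t p D) (fT mk fx κ Φ t p D) : ℤ) * |a|) ≤ (nL κ Φ t p D (gT mk gx κ Φ t p D) (fT mk fx κ Φ t p D) : ℤ) * ((ℓL κ Φ t p D (gT mk gx κ Φ t p D) (fT mk fx κ Φ t p D) : ℤ) + ℓBF κ Φ t p D c mk + 2 * KS0.R'0 κ Φ t p D mk + 1) := by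
    have : (nL κ Φ t p D (gT mk gx κ Φ t p D) (fT mk fx κ Φ t p D) : ℤ) * |2 * a| ≤ (nL κ Φ t p D (gT mk gx κ Φ t p D) (fT mk fx κ Φ t p D) : ℤ) * ((ℓL κ Φ t p D (gT mk gx κ Φ t p D) (fT mk fx κ Φ t p D) : ℤ) + ℓBF κ Φ t p D c mk + 2 * KS0.R'0 κ Φ t p D mk + 1) := mul_le_mul_of_nonneg_left ha' hn0
    rw [abs_mul, show |(2:ℤ)| = 2 by norm_num] at this; linarith
  have h2b : |hL κ Φ t p D (gT mk gx κ Φ t p D) (fT mk fx κ Φ t p D)| * |b| ≤ 10 * (nL κ Φ t p D (gT mk gx κ Φ t p D) (fT mk fx κ Φ t p D) : ℤ) * KS0.R'0 κ Φ t p D mk := mul_le_mul hκ' hb' (abs_nonneg _) (by positivity)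
  have hfl' := mul_le_mul_of_nonneg_left hfl hn0
  -- `n_Lℓ_L + 1 ≤ (n_Lℓ_L/U + 1)·U`
  have hUpos : 0 < shearUnit (nL κ Φ t p D (gT mk gx κ Φ t p D) (fT mk fx κ Φ t p D)) (hL κ Φ t p D (gT mk gx κ Φ t p D) (fT mk fx κ Φ t p D)) := by
    unfold Skelφ.shearUnit; omega
  have hWlo' := Nat.lt_div_mul_add (a := nL κ Φ t p D (gT mk gx κ Φ t p D) (fT mk fx κ Φ t p D) * ℓL κ Φ t p D (gT mk gx κ Φ t p D) (fT mk fx κ Φ t p D)) hUpos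
  have hWlo : (nL κ Φ t p D (gT mk gx κ Φ t p D) (fT mk fx κ Φ t p D) : ℤ) * ℓL κ Φ t p D (gT mk gx κ Φ t p D) (fT mk fx κ Φ t p D) + 1 ≤
      ((nL κ Φ t p D (gT mk gx κ Φ t p D) (fT mk fx κ Φ t p D) * ℓL κ Φ t p D (gT mk gx κ Φ t p D) (fT mk fx κ Φ t p D) /
          shearUnit (nL κ Φ t p D (gT mk gx κ Φ t p D) (fT mk fx κ Φ t p D)) (hL κ Φ t p D (gT mk gx κ Φ t p D) (fT mk fx κ Φ t p D)) + 1 : ℕ) : ℤ) *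
        (shearUnit (nL κ Φ t p D (gT mk gx κ Φ t p D) (fT mk fx κ Φ t p D)) (hL κ Φ t p D (gT mk gx κ Φ t p D) (fT mk fx κ Φ t p D)) : ℤ) := by
    have h' : nL κ Φ t p D (gT mk gx κ Φ t p D) (fT mk fx κ Φ t p D) * ℓL κ Φ t p D (gT mk gx κ Φ t p D) (fT mk fx κ Φ t p D) + 1 ≤
        (nL κ Φ t p D (gT mk gx κ Φ t p D) (fT mk fx κ Φ t p D) * ℓL κ Φ t p D (gT mk gx κ Φ t p D) (fT mk fx κ Φ t p D) /
            shearUnit (nL κ Φ t p D (gT mk gx κ Φ t p D) (fT mk fx κ Φ t p D)) (hL κ Φ t p D (gT mk gx κ Φ t p D) (fT mk fx κ Φ t p D)) + 1) *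
          shearUnit (nL κ Φ t p D (gT mk gx κ Φ t p D) (fT mk fx κ Φ t p D)) (hL κ Φ t p D (gT mk gx κ Φ t p D) (fT mk fx κ Φ t p D)) := by
      rw [Nat.add_mul, one_mul]; omega
    exact_mod_cast h'
  have hab := abs_nonneg (σ * ((nL κ Φ t p D (gT mk gx κ Φ t p D) (fT mk fx κ Φ t p D) : ℤ) * a - hL κ Φ t p D (gT mk gx κ Φ t p D) (fT mk fx κ Φ t p D) * (σ * b)))
  linarith [key, h2a, h2b, hU, hfl', hWlo, abs_nonneg a]

end SameT

end KS

end NegB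

end PlanarSkeletonFrm

end Summit.CriticalPhenomena.PercolationContinuityZ3.Theorems.Transplant

end
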